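import Summits.SmoothPoincare4.SmoothPoincare4.Theorems.CongruenceShadowsAgkCor6SufficiencyStubSmallJointChartCell
import Summits.SmoothPoincare4.SmoothPoincare4.Theorems.CongruenceShadowsAgkCor6SufficiencyStubCentralSurfaceFlower
import Summits.SmoothPoincare4.SmoothPoincare4.Theorems.CongruenceShadowsAgkCor6SufficiencyStubCellBasisGenusZero
import Summits.SmoothPoincare4.SmoothPoincare4.Theorems.CongruenceShadowsAgkCor6SufficiencyStubCellBasisTransport
import Summits.SmoothPoincare4.SmoothPoincare4.Theorems.CongruenceShadowsAgkCor6SufficiencyStubNestedCellsRegion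
import Summits.SmoothPoincare4.SmoothPoincare4.Theorems.CongruenceShadowsAgkCor6SufficiencyStubNestedCellsBasis
import Summits.SmoothPoincare4.SmoothPoincare4.Theorems.CongruenceShadowsAgkCor6SufficiencyStubJcdOfCellBasis
import Literature.Topology.FourManifolds.TrisectionFunctorGKCentralSurface

/-!
# Crux `AgkCor6Sufficiency` (item stmt-SmoothPoincare4-10894), line `lp-by-sphere-system-surgery`:
# the marking statement `GeomMarkingStmt3k` from the punctured flower model alone (r6b assembly)

With the seven generic cell lemmas of reshape r6b landed (`stub_smallJointChartCell`,
`stub_centralSurfaceFlower`, `stub_cellBasisGenusZero`, `stub_cellBasisTransport`,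
`stub_nestedCellsRegion`, `stub_nestedCellsBasis`, `stub_jcdOfCellBasis`), the marking statement
the Nielsen-free deciding theorem consumes, `GeomMarkingStmt3k` (`…GeomMarkingDefs.lean`), follows
from ONE model computation, `PuncturedFlowerModel g` for `g ≥ 2` — the flower surface minus a disc
has free `π₁` of rank `2g` reading the boundary circle (`geomMarking3k_of_puncturedFlowerModel`).
Whence the crux from LP + Griffiths + DNB-surface + the punctured flower model + the JCD step
(`agkCor6Sufficiency_of_facts_of_model`, both route decls) — CONDITIONAL result: of the crux's
geometric debt only `PuncturedFlowerModel` (explicit surface topology, in flight on the line) and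
`JCDStepStmt` (Gay–Kirby's implant ON THE NOSE, crux-sized) remain, besides the three delegated
classical facts.

References: Abrams–Gay–Kirby, Geom. Topol. 22 (2018), Thm. 5, Cor. 6 [AbramsGayKirby2018];
Gay–Kirby, Geom. Topol. 20 (2016), Def. 1, Lemma 10 [GayKirby2016]; Hatcher, Algebraic Topology
(2002), §1.2 p. 51 [HatcherAT2002]; Moise, Geometric topology in dimensions 2 and 3 (1977), Ch. 4
(the annulus theorem) [Moise1977].
-/

set_option linter.dupNamespace false

noncomputable section

open Set Function ContinuousMap Metric
open scoped Manifold ContDiff Topology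

namespace Summit.SmoothPoincare4.SmoothPoincare4.Cruxes.AgkCor6Sufficiency.LpBySphereSystemSurgery

open Literature.Topology.FourManifolds
open Literature.AlgebraicTopology.FundamentalGroup
open Literature.AlgebraicTopology.FundamentalGroup.VanKampen
open Literature.AlgebraicTopology.Homotopy
open Summit.SmoothPoincare4.SmoothPoincare4.Theses.CongruenceShadows (AgkCor6Sufficiency)

/-! ## 3. Assembly of the marking statement (proved from the pieces) -/

section Assembly

variable {X : Type} [TopologicalSpace X]

/-- The hole of a chart-like cell is the trace on `F` of an open set of the ambient space
(remove the compact annulus `Φ(1 ≤ ‖z‖ ≤ 2)` from `O`). -/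
theorem exists_isOpen_inter_eq_cellHole [T2Space X] {F : Set X}
    (Φ : C(closedBall (0 : EuclideanSpace ℝ (Fin 2)) 2, X)) (O : Set X) (hc : IsChartCell F Φ O) :
    ∃ U : Set X, IsOpen U ∧ F ∩ U = cellHole Φ := by
  obtain ⟨hinj, -, hO, hFO⟩ := hc
  set K : Set X := Φ '' {z | 1 ≤ ‖(z : EuclideanSpace ℝ (Fin 2))‖} with hK
  have hKc : IsCompact K := by
    haveI : CompactSpace (closedBall (0 : EuclideanSpace ℝ (Fin 2)) 2) :=
      isCompact_iff_compactSpace.mp (isCompact_closedBall _ _)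
    refine IsCompact.image (IsClosed.isCompact ?_) Φ.continuous
    exact isClosed_le continuous_const (continuous_norm.comp continuous_subtype_val)
  refine ⟨O \ K, hO.sdiff hKc.isClosed, ?_⟩
  rw [← inter_sdiff_assoc, hFO]
  ext y
  simp only [mem_sdiff, mem_image, mem_setOf_eq, cellHole, hK]
  constructor
  · rintro ⟨⟨z, hz, rfl⟩, hy⟩
    refine ⟨z, ?_, rfl⟩
    by_contra hlt
    exact hy ⟨z, not_lt.mp hlt, rfl⟩
  · rintro ⟨z, hz, rfl⟩
    refine ⟨⟨z, by linarith, rfl⟩, ?_⟩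
    rintro ⟨w, hw, hwz⟩
    have : w = z := hinj hwz
    subst this
    exact absurd hz (not_lt.mpr hw)

/-- **The marking statement at `g = 3k` from the punctured flower model ALONE** (the seven generic
pieces of the line being landed): genus `0` from `stub_cellBasisGenusZero`; genus `3k ≥ 3` by
transporting the punctured flower model to the central surface (`stub_centralSurfaceFlower`,
`stub_cellBasisTransport`), placing a small joint-chart cell inside the transported hole
(`stub_smallJointChartCell`), descending the cell basis through the annulus
(`stub_nestedCellsRegion`, `stub_nestedCellsBasis` — the 2D annulus theorem), and packaging
(`stub_jcdOfCellBasis`).  CONDITIONAL on `PuncturedFlowerModel g` for `g ≥ 2` (registered stub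
`stub_puncturedFlowerModel`). [cite: GayKirby2016, Def. 1] [cite: HatcherAT2002, §1.2 p. 51] -/
theorem geomMarking3k_of_puncturedFlowerModel
    (hPFM : ∀ g : ℕ, 2 ≤ g → PuncturedFlowerModel g) : GeomMarkingStmt3k := by
  intro X _ _ _ _ _ _ _ o k S h
  have hGK : IsGKTrisection X (3 * k) (fun _ => k) S := h
  have hFc : IsClosed (⋂ m, S m) := hGK.isCompact_iInter.isClosed
  rcases Nat.eq_zero_or_pos k with rfl | hk
  · -- genus `0`
    obtain ⟨x⟩ := hGK.nonempty_centralSurface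
    obtain ⟨Θ, l, ρ, Φ, O, hΘ, -, -, hl0, hl1, hSi, hF, hSj, hSl, hρ, hsrc, hΘΦ, -, hinj, hΦF, hO,
      hOsrc, -, hOeq, hFO⟩ := hGK.exists_jointChart_cell (i := 0) (j := 1) (by decide) x.2
    have hc : IsChartCell (⋂ m, S m) Φ O := ⟨hinj, hΦF, hO, hFO⟩
    have h0 : IsBalancedGKTrisection X 0 0 S := by simpa using h
    have hB : CellBasis (⋂ m, S m) Φ (3 * 0) := by
      simpa using stub_cellBasisGenusZero X o 0 S h0 Φ O hc
    obtain ⟨μ, hJ⟩ := stub_jcdOfCellBasis hGK Θ 0 1 l ρ Φ O hΘ (by decide) hl0 hl1 hSi hF hSj hSl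
      hρ hsrc hΘΦ hinj hΦF hO hOsrc hOeq hFO hB
    exact ⟨_, μ, hJ⟩
  · -- genus `3k ≥ 3`: the flower model
    have hg : 2 ≤ 3 * k := by omega
    obtain ⟨e⟩ := stub_centralSurfaceFlower hg X o k S h
    obtain ⟨Ψ, OZ, hcZ, hbZ⟩ := hPFM (3 * k) hg
    obtain ⟨Ψ', O', -, hc', hb'⟩ := stub_cellBasisTransport hFc e Ψ OZ hcZ hbZ
    -- a small joint-chart cell centred at the centre of `Ψ'`
    obtain ⟨U, hU, hFU⟩ := exists_isOpen_inter_eq_cellHole Ψ' O' hc'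
    have hxhole : Ψ' ⟨0, by simp⟩ ∈ cellHole Ψ' := ⟨⟨0, by simp⟩, by simp, rfl⟩
    have hxFU : Ψ' ⟨0, by simp⟩ ∈ (⋂ m, S m) ∩ U := by rw [hFU]; exact hxhole
    obtain ⟨Θ, l, ρ, Φ, O, hΘ, -, -, hl0, hl1, hSi, hF, hSj, hSl, hρ, hsrc, hΘΦ, -, hinj, hΦF, hO,
      hOsrc, -, hOeq, hFO, hsU⟩ :=
      stub_smallJointChartCell hGK (i := 0) (j := 1) (by decide) hxFU.1 hU hxFU.2
    have hcΦ : IsChartCell (⋂ m, S m) Φ O := ⟨hinj, hΦF, hO, hFO⟩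
    have hnest : cellDisc Φ ⊆ cellHole Ψ' := by
      rintro _ ⟨z, -, rfl⟩
      have : Φ z ∈ (⋂ m, S m) ∩ U := ⟨hΦF ⟨z, rfl⟩, hsU (hsrc z)⟩
      rwa [hFU] at this
    obtain ⟨hsdr, hRpc, hx, hCR, hgen⟩ := stub_nestedCellsRegion hFc Φ Ψ' O O' hcΦ hc' hnest
    have hB : CellBasis (⋂ m, S m) Φ (3 * k) :=
      stub_nestedCellsBasis hFc Φ Ψ' O O' hcΦ hc' hnest hsdr hRpc hx hCR hgen hb'
    obtain ⟨μ, hJ⟩ := stub_jcdOfCellBasis hGK Θ 0 1 l ρ Φ O hΘ (by decide) hl0 hl1 hSi hF hSj hSl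
      hρ hsrc hΘΦ hinj hΦF hO hOsrc hOeq hFO hB
    exact ⟨_, μ, hJ⟩

end Assembly

/-! ## The crux from the model -/

/-- **The crux of route `CongruenceShadows` from LP, Griffiths, DNB-surface, the punctured flower
model and the JCD step** — CONDITIONAL result. [cite: AbramsGayKirby2018, Cor. 6 and Thm. 5 (p. 1541)] -/
theorem agkCor6Sufficiency_of_facts_of_model (hLP : exists_diffeomorph_comp_incl_eq.{0})
    (hGr : GriffithsExtension) (hDS : DehnNielsenBaerSurfaceSmooth)
    (hPFM : ∀ g : ℕ, 2 ≤ g → PuncturedFlowerModel g) (hJ : JCDStepStmt) : AgkCor6Sufficiency :=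
  agkCor6Sufficiency_of_facts_nielsenFree3k hLP hGr hDS (geomMarking3k_of_puncturedFlowerModel hPFM) hJ

/-- **The same for the shared decl of route `GroupTrisection`** — CONDITIONAL result.
[cite: AbramsGayKirby2018, Cor. 6 and Thm. 5 (p. 1541)] -/
theorem agkCor6Sufficiency'_of_facts_of_model (hLP : exists_diffeomorph_comp_incl_eq.{0})
    (hGr : GriffithsExtension) (hDS : DehnNielsenBaerSurfaceSmooth)
    (hPFM : ∀ g : ℕ, 2 ≤ g → PuncturedFlowerModel g) (hJ : JCDStepStmt) :
    Summit.SmoothPoincare4.SmoothPoincare4.Theses.GroupTrisection.AgkCor6Sufficiency :=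
  agkCor6Sufficiency'_of_facts_nielsenFree3k hLP hGr hDS (geomMarking3k_of_puncturedFlowerModel hPFM) hJ

end Summit.SmoothPoincare4.SmoothPoincare4.Cruxes.AgkCor6Sufficiency.LpBySphereSystemSurgery

end
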